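import Mathlib.Algebra.Order.BigOperators.Group.Finset
import Mathlib.Algebra.BigOperators.Ring.Finset
import Mathlib.Tactic
import HarnessLib

/-!
# Weighted Chebyshev sum inequality and the variance step (B2) of the CORE-LEMMA proof

Support file for the Sahi / Conjecture-P programme of route `PercNearOneGluingNoHeavy`
(`--supports stmt-CriticalPhenomena-4575`, prover prim-l12-p5 gen 26; proof note
`prim-l12-p5/CORE-g26.md` §5.5).  No definitions, no named facts, no sorries.

Setting (note §5.5).  In the proof of the CORE LEMMA (⟹ THEOREM DF1) the weight `ν` on the
half-integer line factors as `ν = ν₀ · Ψ` with `ν₀` the centred law of `Hyp(N; n₁; N/2)` and `Ψ ≥ 0`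
nonincreasing in `|t|`, and one needs `E_ν[T²] ≤ E_{ν₀}[T²]`: tilting a law by a weight that is
oppositely ordered to `t²` cannot increase the second moment.  This is the weighted Chebyshev sum
inequality, proved here for an arbitrary finite index set:

* `sum_mul_sum_antivary` : if `ν ≥ 0` and `f`, `g` are oppositely ordered
  (`(f i - f j)(g i - g j) ≤ 0` for all `i, j`), then `(∑ ν)(∑ ν f g) ≤ (∑ ν f)(∑ ν g)`;
* `tilted_moment_le` : the consequence `(∑ ν₀ Ψ f)·(∑ ν₀) ≤ (∑ ν₀ f)·(∑ ν₀ Ψ)` used as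
  `E_{ν₀Ψ}[f] ≤ E_{ν₀}[f]` for `f` nondecreasing and `Ψ` nonincreasing along a common order
  (in the note: `f = t²`, order = `|t|`).
-/

namespace Summit.CriticalPhenomena.PercolationContinuityZ3.Theorems

namespace PeakTilt

open Finset

variable {ι : Type*} (s : Finset ι) (ν f g : ι → ℝ)

/-- Antisymmetrisation identity behind Chebyshev's sum inequality:
`2[(∑ν)(∑νfg) − (∑νf)(∑νg)] = ∑_i ∑_j ν_i ν_j (f_i − f_j)(g_i − g_j)`. -/
theorem two_mul_cheb_gap :
    2 * ((∑ i ∈ s, ν i) * (∑ i ∈ s, ν i * (f i * g i)) -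
        (∑ i ∈ s, ν i * f i) * (∑ i ∈ s, ν i * g i)) =
      ∑ i ∈ s, ∑ j ∈ s, ν i * ν j * ((f i - f j) * (g i - g j)) := by
  have h1 : (∑ i ∈ s, ν i) * (∑ i ∈ s, ν i * (f i * g i)) =
      ∑ i ∈ s, ∑ j ∈ s, ν i * (ν j * (f j * g j)) := by
    rw [sum_mul_sum]
  have h2 : (∑ i ∈ s, ν i * f i) * (∑ i ∈ s, ν i * g i) =
      ∑ i ∈ s, ∑ j ∈ s, ν i * f i * (ν j * g j) := by
    rw [sum_mul_sum]
  have h3 : (∑ i ∈ s, ν i * (f i * g i)) * (∑ i ∈ s, ν i) =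
      ∑ i ∈ s, ∑ j ∈ s, ν i * (f i * g i) * ν j := by
    rw [sum_mul_sum]
  have h4 : (∑ i ∈ s, ν i * g i) * (∑ i ∈ s, ν i * f i) =
      ∑ i ∈ s, ∑ j ∈ s, ν i * g i * (ν j * f j) := by
    rw [sum_mul_sum]
  have key : ∑ i ∈ s, ∑ j ∈ s, ν i * ν j * ((f i - f j) * (g i - g j)) =
      (∑ i ∈ s, ∑ j ∈ s, ν i * (ν j * (f j * g j))) + (∑ i ∈ s, ∑ j ∈ s, ν i * (f i * g i) * ν j)
        - (∑ i ∈ s, ∑ j ∈ s, ν i * f i * (ν j * g j)) - (∑ i ∈ s, ∑ j ∈ s, ν i * g i * (ν j * f j)) := by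
    rw [← sum_add_distrib, ← sum_sub_distrib, ← sum_sub_distrib]
    refine sum_congr rfl fun i _ => ?_
    rw [← sum_add_distrib, ← sum_sub_distrib, ← sum_sub_distrib]
    refine sum_congr rfl fun j _ => ?_
    ring
  rw [key, ← h1, ← h2, ← h3, ← h4]
  ring

/-- **Weighted Chebyshev sum inequality.**  For `ν ≥ 0` and `f`, `g` oppositely ordered,
`(∑ ν)(∑ ν f g) ≤ (∑ ν f)(∑ ν g)`. -/
theorem sum_mul_sum_antivary (hν : ∀ i ∈ s, 0 ≤ ν i)
    (hfg : ∀ i ∈ s, ∀ j ∈ s, (f i - f j) * (g i - g j) ≤ 0) :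
    (∑ i ∈ s, ν i) * (∑ i ∈ s, ν i * (f i * g i)) ≤
      (∑ i ∈ s, ν i * f i) * (∑ i ∈ s, ν i * g i) := by
  have h := two_mul_cheb_gap s ν f g
  have hnonpos : ∑ i ∈ s, ∑ j ∈ s, ν i * ν j * ((f i - f j) * (g i - g j)) ≤ 0 := by
    refine sum_nonpos fun i hi => sum_nonpos fun j hj => ?_
    exact mul_nonpos_of_nonneg_of_nonpos (mul_nonneg (hν i hi) (hν j hj)) (hfg i hi j hj)
  linarith

/-- **The tilting step (B2) of the note.**  If `ν₀ ≥ 0`, `Ψ ≥ 0`, and along some order parameter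
`d` the function `f` is nondecreasing while `Ψ` is nonincreasing, then the `Ψ`-tilted `ν₀`-average
of `f` is at most the untilted one: `(∑ ν₀ Ψ f)(∑ ν₀) ≤ (∑ ν₀ f)(∑ ν₀ Ψ)`. -/
theorem tilted_moment_le (ν₀ Ψ φ d : ι → ℝ) (hν : ∀ i ∈ s, 0 ≤ ν₀ i)
    (hφ : ∀ i ∈ s, ∀ j ∈ s, d i ≤ d j → φ i ≤ φ j)
    (hΨ : ∀ i ∈ s, ∀ j ∈ s, d i ≤ d j → Ψ j ≤ Ψ i) :
    (∑ i ∈ s, ν₀ i * (φ i * Ψ i)) * (∑ i ∈ s, ν₀ i) ≤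
      (∑ i ∈ s, ν₀ i * φ i) * (∑ i ∈ s, ν₀ i * Ψ i) := by
  have hopp : ∀ i ∈ s, ∀ j ∈ s, (φ i - φ j) * (Ψ i - Ψ j) ≤ 0 := by
    intro i hi j hj
    rcases le_total (d i) (d j) with hij | hji
    · exact mul_nonpos_of_nonpos_of_nonneg (sub_nonpos.mpr (hφ i hi j hj hij))
        (sub_nonneg.mpr (hΨ i hi j hj hij))
    · exact mul_nonpos_of_nonneg_of_nonpos (sub_nonneg.mpr (hφ j hj i hi hji))
        (sub_nonpos.mpr (hΨ j hj i hi hji))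
  have h := sum_mul_sum_antivary s ν₀ φ Ψ hν hopp
  linarith

end PeakTilt

end Summit.CriticalPhenomena.PercolationContinuityZ3.Theorems
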